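import Summits.BirchSwinnertonDyer.Rank1Residual.Additive.PadicClosureCyclotomicTower
import Literature.NumberTheory.GaloisRepresentations.AbsGaloisGroup
import Mathlib.GroupTheory.Index
import HarnessLib

/-!
# The local cyclotomic tower INSIDE `ℚ̄_p = PadicAlgCl p`, III: the stabilisers
# `Γ_n = Stab(ζ_{p^n}) ≤ Gal(ℚ̄_p/ℚ_p)` (normal — as a theorem, antitone, of index `φ(p^n)`, `[Γ_n : Γ_{n+1}] = p`),
# the Galois correspondence `ℚ̄_p^{Γ_n} = ℚ_p(ζ_{p^n})`, and the TRACE SUMS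
# `∑_{Γ_n/Γ_{n+1}} σ(ζ_{p^{n+1}} − 1) = −p` — cell `b2b-bsdres`, CLASS-CLOSURE lane, class O10 — x1b
# GEN 33, class lead; file 20 of the local series (the Galois side of [K] Lemma 8.9:
# `Tr_{n+1/n}(ζ_{p^{n+2}} − 1) = −p`, `Tr_{k_0/ℚ_p}(ζ_p − 1) = −p`)

HONEST FRAMING (cell `b2b-bsdres`, run/shared/lean/b2b/bsd-rank1-residual/, verbatim in every
file): the goal of the cell is to DELETE the COMBINATION-SHAPED residual classes of the
Birch–Swinnerton-Dyer formula for ALL analytic-rank `≤ 1` elliptic curves over `ℚ` — "full BSD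
formula for every rank `≤ 1` curve in class `C`" assembled STRICTLY from published theorems — so
that the rank-`≤ 1` remainder becomes exactly the CONSTRUCTION-SHAPED classes, which are TYPED
(missing-input `Prop`s), NOT attempted. This is not "finishing BSD". CLASS-CLOSURE lane: prove
what is provable now; shrink each hard class to its core with data; no claim beyond stated classes;
research routes on CONSTRUCTION-SHAPED X12 / O10; census / instrument output = EVIDENCE / conjecture
items, NEVER a Literature fact; `RESIDUAL-MAP.md` marks change only by signed lines. THIS FILE:
TOOL DEFINITION + THEOREMS (one definition with body: `stab p m`, the stabiliser of `ζ_{p^m}` in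
the cell's `Γ_{ℚ_p} = Field.absoluteGaloisGroup ℚ_[p]`; every statement proved) — no named
Literature fact, no Summits-side fact `def … : Prop`, no `sorry`, axioms standard; nothing is booked;
no label / mark / count / sub-cell moves; O10 stays OPEN / CONSTRUCTION-SHAPED; nothing about
`BSD(W, p)` of any pair is claimed.

## What is here (`Γ = Field.absoluteGaloisGroup ℚ_[p]` acting on `Ω = PadicAlgCl p` by the tree's
## `instMulSemiringActionAlgebraicClosure`; `ζ m = zeta p m`; `stab p m = Stab_Γ(ζ m)`)

* §5 `stab p m` (Kobayashi's `Gal(ℚ̄_p/k_{m−1})`; `stab p 0 = ⊤`): antitone, NORMAL, fixes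
  `layer p m` pointwise and conversely (`mem_layer_iff_forall_smul_eq`: `Ω^{stab m} = ℚ_p(ζ m)`),
  `smul_mem_layer`; index `[Γ : stab m] = φ(p^m)` (`index_stab`, via Mathlib
  `IntermediateField.finrank_eq_fixingSubgroup_index`), `FiniteIndex`, and the relative index
  `[stab m : stab (m+1)] = p` for `m ≥ 1`, `= p − 1` for `m = 0` (`index_subgroupOf_stab_succ`).
* §6 **Trace sums** over coset representatives of `stab (m+1)` in `stab m` (the indexing of
  cc-typer-6's `localPairTraceOfEmb`): for `x` fixed by `stab m` the sum is `[stab m : stab (m+1)] • x`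
  (`sum_out_smul_of_forall_smul_eq`); **`sum_out_smul_zeta_succ_sub_one`:
  `∑_q q̃ • (ζ (m+1) − 1) = −p` for EVERY `m ≥ 0`** (for `m ≥ 1` the conjugates of `ζ (m+1)` over
  `layer m` are the `ζ (m+1) ω^j`, `ω` a primitive `p`-th root, summing to `0`; for `m = 0` they are the
  primitive `p`-th roots, summing to `−1`) — Kobayashi's `Tr_{n+1/n}` computation in Lemma 8.9.

References: [Kobayashi2003] §8.4, Lemma 8.9 (proof); [SerreLocalFields1979] Ch. IV §4;
[NeukirchANT1999] II (7.13), IV §1.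
-/

noncomputable section

open scoped Classical IntermediateField
open Polynomial

namespace Summit.BirchSwinnertonDyer.Rank1Residual.Additive

namespace PadicCyclotomicTower

open Field Field.absoluteGaloisGroup

variable (p : ℕ) [hp : Fact p.Prime]

/-! ## §5 The stabilisers `stab p m ≤ Γ_{ℚ_p}` -/

/-- **The stabiliser of `ζ_{p^m}` in `Γ = Gal(ℚ̄_p/ℚ_p)`** (= `Gal(ℚ̄_p/ℚ_p(ζ_{p^m}))`; Kobayashi's
`Gal(ℚ̄_p/k_{m−1})`, and `stab p 0 = Γ` for `k_{−1} = ℚ_p`). [cite: Kobayashi2003, §8.4] -/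
def stab (m : ℕ) : Subgroup (absoluteGaloisGroup ℚ_[p]) :=
  MulAction.stabilizer (absoluteGaloisGroup ℚ_[p]) (zeta p m)

variable {p}

/-- Membership in `stab p m`: `σ • ζ m = ζ m`. [folklore] -/
theorem mem_stab_iff {m : ℕ} (σ : absoluteGaloisGroup ℚ_[p]) :
    σ ∈ stab p m ↔ σ • zeta p m = zeta p m :=
  MulAction.mem_stabilizer_iff

/-- Membership in `stab p m` through the underlying automorphism. [folklore] -/
theorem mem_stab_iff_toAlgEquiv {m : ℕ} (σ : absoluteGaloisGroup ℚ_[p]) :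
    σ ∈ stab p m ↔ toAlgEquiv ℚ_[p] σ (zeta p m) = zeta p m :=
  MulAction.mem_stabilizer_iff

variable (p)

/-- `stab p 0 = ⊤` (`ζ 0 = 1`). [folklore] -/
theorem stab_zero : stab p 0 = ⊤ := by
  ext σ
  simp only [mem_stab_iff, zeta_zero, smul_one, Subgroup.mem_top]

/-- The stabilisers decrease: `stab p m' ≤ stab p m` for `m ≤ m'` (`ζ m = (ζ m')^{p^{m'−m}}`).
[folklore] -/
theorem stab_antitone : Antitone (stab p) := by
  intro m m' h σ hσ
  obtain ⟨j, rfl⟩ := Nat.exists_eq_add_of_le h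
  rw [mem_stab_iff] at hσ ⊢
  rw [← zeta_add_pow p m j, smul_pow', hσ]

variable {p}

/-- An element of `stab p m` fixes `layer p m` pointwise. [folklore] -/
theorem smul_eq_self_of_mem_stab {m : ℕ} {σ : absoluteGaloisGroup ℚ_[p]} (hσ : σ ∈ stab p m)
    {x : PadicAlgCl p} (hx : x ∈ layer p m) : σ • x = x := by
  rw [smul_def]
  exact apply_eq_self_of_apply_zeta_eq p ((mem_stab_iff_toAlgEquiv σ).mp hσ) hx

/-- **Galois correspondence on the layers**: `x ∈ layer p m ↔ x` is fixed by `stab p m`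
(`ℚ̄_p^{Stab ζ_{p^m}} = ℚ_p(ζ_{p^m})`). [cite: NeukirchANT1999, Ch. IV §1] -/
theorem mem_layer_iff_forall_smul_eq {m : ℕ} (x : PadicAlgCl p) :
    x ∈ layer p m ↔ ∀ σ ∈ stab p m, σ • x = x := by
  refine ⟨fun hx σ hσ => smul_eq_self_of_mem_stab hσ hx, fun h => ?_⟩
  refine mem_layer_of_forall_apply_eq p fun τ hτ => ?_
  have hmem : (toAlgEquiv ℚ_[p]).symm τ ∈ stab p m := by
    rw [mem_stab_iff, toAlgEquiv_symm_apply]; exact hτ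
  have := h _ hmem
  rwa [toAlgEquiv_symm_apply] at this

/-- The layers are `Γ`-stable. [folklore] -/
theorem smul_mem_layer {m : ℕ} (σ : absoluteGaloisGroup ℚ_[p]) {x : PadicAlgCl p}
    (hx : x ∈ layer p m) : σ • x ∈ layer p m := by
  rw [smul_def]; exact apply_mem_layer p _ hx

/-- **`stab p m` is normal in `Γ`** (the layer is Galois over `ℚ_p`: `σ⁻¹ ζ ∈ layer m` is fixed by
every `τ ∈ stab m`). [cite: NeukirchANT1999, Ch. IV §1] -/
theorem normal_stab (m : ℕ) : (stab p m).Normal := by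
  refine ⟨fun τ hτ σ => ?_⟩
  rw [mem_stab_iff, mul_smul, mul_smul]
  have h1 : σ⁻¹ • zeta p m ∈ layer p m := smul_mem_layer σ⁻¹ (zeta_mem_layer p m)
  rw [smul_eq_self_of_mem_stab hτ h1, smul_inv_smul]

/-- `stab p m` is the pull-back of the fixing subgroup of `layer p m` along the identification
`Γ = Aut(ℚ̄_p/ℚ_p)`. [folklore] -/
theorem stab_eq_comap_fixingSubgroup (m : ℕ) :
    stab p m = ((layer p m).fixingSubgroup).comap (toAlgEquiv ℚ_[p]).toMonoidHom := by
  ext σ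
  rw [Subgroup.mem_comap, MulEquiv.coe_toMonoidHom, mem_fixingSubgroup_layer_iff,
    mem_stab_iff_toAlgEquiv]

variable (p)

/-- **`[Γ : stab p m] = φ(p^m)`** for `m ≥ 1` (`= [ℚ_p(ζ_{p^m}) : ℚ_p]`, Mathlib
`IntermediateField.finrank_eq_fixingSubgroup_index`). [cite: SerreLocalFields1979, Ch. IV §4] -/
theorem index_stab {m : ℕ} (hm : 1 ≤ m) : (stab p m).index = (p ^ m).totient := by
  rw [stab_eq_comap_fixingSubgroup, Subgroup.index_comap_of_surjective _ (toAlgEquiv ℚ_[p]).surjective,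
    ← IntermediateField.finrank_eq_fixingSubgroup_index, finrank_layer p hm]

/-- `[Γ : stab p 0] = 1`. [folklore] -/
theorem index_stab_zero : (stab p 0).index = 1 := by
  rw [stab_zero, Subgroup.index_top]

/-- `[Γ : stab p m] = φ(p^m)` for all `m` (`φ(1) = 1`). [folklore] -/
theorem index_stab' (m : ℕ) : (stab p m).index = (p ^ m).totient := by
  rcases Nat.eq_zero_or_pos m with rfl | hm
  · rw [index_stab_zero, pow_zero, Nat.totient_one]
  · exact index_stab p hm

/-- The stabilisers have finite index. [folklore] -/
theorem finiteIndex_stab (m : ℕ) : (stab p m).FiniteIndex :=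
  ⟨by rw [index_stab']; exact (Nat.totient_pos.mpr (pow_pos hp.out.pos m)).ne'⟩

/-- **The relative index `[stab p m : stab p (m+1)] = φ(p^{m+1})/φ(p^m)`**, i.e. `p` for `m ≥ 1`
and `p − 1` for `m = 0` (`[k_m : k_{m−1}] = p`, `[k_0 : ℚ_p] = p − 1`). [cite: Kobayashi2003, §8.4]
[cite: SerreLocalFields1979, Ch. IV §4] -/
theorem index_subgroupOf_stab_succ (m : ℕ) :
    ((stab p (m + 1)).subgroupOf (stab p m)).index = if m = 0 then p - 1 else p := by
  have hrel : ((stab p (m + 1)).subgroupOf (stab p m)).index * (stab p m).index =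
      (stab p (m + 1)).index :=
    Subgroup.relIndex_mul_index (stab_antitone p (Nat.le_succ m))
  rw [index_stab', index_stab'] at hrel
  rcases Nat.eq_zero_or_pos m with rfl | hm
  · rw [if_pos rfl]
    rw [pow_zero, Nat.totient_one, mul_one, zero_add, pow_one, Nat.totient_prime hp.out] at hrel
    exact hrel
  · rw [if_neg hm.ne']
    obtain ⟨k, rfl⟩ := Nat.exists_eq_add_of_le' hm
    rw [Nat.totient_prime_pow_succ hp.out, Nat.totient_prime_pow_succ hp.out, pow_succ] at hrel
    have hne : p ^ k * (p - 1) ≠ 0 :=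
      mul_ne_zero (pow_ne_zero k hp.out.ne_zero) (Nat.sub_ne_zero_of_lt hp.out.one_lt)
    apply mul_right_cancel₀ hne
    rw [hrel]; ring

/-! ## §6 Trace sums over `stab p m / stab p (m+1)` -/

/-- A sum over an injective family whose values exhaust a finset of the same size is the sum
over that finset. [folklore] -/
theorem sum_eq_finset_sum_of_injective {ι : Type*} [Fintype ι] {f : ι → PadicAlgCl p}
    (hf : Function.Injective f) (T : Finset (PadicAlgCl p)) (hT : ∀ i, f i ∈ T)
    (hcard : Fintype.card ι = T.card) : ∑ i, f i = ∑ t ∈ T, t := by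
  have himg : (Finset.univ : Finset ι).image f = T := by
    refine Finset.eq_of_subset_of_card_le (fun t ht => ?_) ?_
    · obtain ⟨i, -, rfl⟩ := Finset.mem_image.mp ht
      exact hT i
    · rw [Finset.card_image_of_injective _ hf, Finset.card_univ, hcard]
  rw [← himg, Finset.sum_image fun i _ j _ h => hf h]

variable {p}

/-- The coset sum is injective on representatives: `q̃ • ζ (m+1) = q̃' • ζ (m+1) ⟹ q = q'`. [folklore] -/
theorem out_smul_zeta_injective (m : ℕ) :
    Function.Injective fun q : stab p m ⧸ (stab p (m + 1)).subgroupOf (stab p m) =>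
      ((q.out : stab p m) : absoluteGaloisGroup ℚ_[p]) • zeta p (m + 1) := by
  intro q q' h
  simp only at h
  rw [← QuotientGroup.out_eq' q, ← QuotientGroup.out_eq' q', QuotientGroup.eq, Subgroup.mem_subgroupOf,
    Subgroup.coe_mul, Subgroup.coe_inv, mem_stab_iff, mul_smul, ← h, inv_smul_smul]

/-- **For `x` fixed by `stab p m` the coset sum is multiplication by the index.** [folklore] -/
theorem sum_out_smul_of_forall_smul_eq (m : ℕ)
    [Fintype (stab p m ⧸ (stab p (m + 1)).subgroupOf (stab p m))] {x : PadicAlgCl p}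
    (hx : ∀ σ ∈ stab p m, σ • x = x) :
    ∑ q : stab p m ⧸ (stab p (m + 1)).subgroupOf (stab p m),
        ((q.out : stab p m) : absoluteGaloisGroup ℚ_[p]) • x =
      ((stab p (m + 1)).subgroupOf (stab p m)).index • x := by
  have : ∀ q : stab p m ⧸ (stab p (m + 1)).subgroupOf (stab p m),
      ((q.out : stab p m) : absoluteGaloisGroup ℚ_[p]) • x = x := fun q => hx _ q.out.2
  simp_rw [this, Finset.sum_const, Finset.card_univ, Subgroup.index, Nat.card_eq_fintype_card]

variable (p)

/-- A Galois conjugate of `ζ (m+1)` over `layer m` (`m ≥ 1`) is `ζ (m+1) · ω^j` with `ω = ζ 1`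
the primitive `p`-th root of the system, `j < p`. [cite: Kobayashi2003, Lemma 8.9 (proof)] -/
theorem exists_smul_zeta_succ_eq_mul_pow {m : ℕ} {σ : absoluteGaloisGroup ℚ_[p]} (hσ : σ ∈ stab p m) :
    ∃ j < p, σ • zeta p (m + 1) = zeta p (m + 1) * zeta p 1 ^ j := by
  have hζ0 : zeta p (m + 1) ≠ 0 := (isPrimitiveRoot_zeta p (m + 1)).ne_zero (NeZero.ne _)
  have hω : IsPrimitiveRoot (zeta p 1) p := by simpa using isPrimitiveRoot_zeta p 1
  set y := σ • zeta p (m + 1) with hy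
  have hyp : y ^ p = zeta p (m + 1) ^ p := by
    rw [hy, ← smul_pow', zeta_succ_pow, (mem_stab_iff σ).mp hσ]
  have hμ : (y * (zeta p (m + 1))⁻¹) ^ p = 1 := by
    rw [mul_pow, hyp, inv_pow, mul_inv_cancel₀ (pow_ne_zero _ hζ0)]
  haveI : NeZero p := ⟨hp.out.ne_zero⟩
  obtain ⟨j, hj, hjy⟩ := hω.eq_pow_of_pow_eq_one hμ
  refine ⟨j, hj, ?_⟩
  rw [hjy, mul_comm, inv_mul_cancel_right₀ hζ0]

/-- **`∑_{stab m / stab (m+1)} q̃ • ζ (m+1) = 0` for `m ≥ 1`** (`Tr_{k_m/k_{m−1}} ζ_{p^{m+1}} = 0`: the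
conjugates are the `ζ (m+1) ω^j`, `j < p`, and `∑_{j<p} ω^j = 0`). [cite: Kobayashi2003, Lemma 8.9 (proof)] -/
theorem sum_out_smul_zeta_succ_of_pos {m : ℕ} (hm : 1 ≤ m)
    [Fintype (stab p m ⧸ (stab p (m + 1)).subgroupOf (stab p m))] :
    ∑ q : stab p m ⧸ (stab p (m + 1)).subgroupOf (stab p m),
        ((q.out : stab p m) : absoluteGaloisGroup ℚ_[p]) • zeta p (m + 1) = 0 := by
  have hω : IsPrimitiveRoot (zeta p 1) p := by simpa using isPrimitiveRoot_zeta p 1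
  have hζ0 : zeta p (m + 1) ≠ 0 := (isPrimitiveRoot_zeta p (m + 1)).ne_zero (NeZero.ne _)
  set T : Finset (PadicAlgCl p) :=
    (Finset.range p).image fun j => zeta p (m + 1) * zeta p 1 ^ j with hT
  have hinj : Set.InjOn (fun j => zeta p (m + 1) * zeta p 1 ^ j) (Finset.range p : Set ℕ) := by
    intro j hj j' hj' h
    simp only [Finset.coe_range, Set.mem_Iio] at hj hj'
    exact hω.pow_inj hj hj' (mul_left_cancel₀ hζ0 h)
  have hTcard : T.card = p := by rw [hT, Finset.card_image_of_injOn hinj, Finset.card_range]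
  have hQcard : Fintype.card (stab p m ⧸ (stab p (m + 1)).subgroupOf (stab p m)) = T.card := by
    rw [hTcard, ← Nat.card_eq_fintype_card, ← Subgroup.index, index_subgroupOf_stab_succ, if_neg]
    omega
  rw [sum_eq_finset_sum_of_injective p (out_smul_zeta_injective m) T (fun q => ?_) hQcard]
  · rw [hT, Finset.sum_image hinj, ← Finset.mul_sum, hω.geom_sum_eq_zero hp.out.one_lt, mul_zero]
  · obtain ⟨j, hj, hjq⟩ := exists_smul_zeta_succ_eq_mul_pow p (q.out).2
    rw [hT, Finset.mem_image]
    exact ⟨j, Finset.mem_range.mpr hj, hjq.symm⟩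

/-- **`∑_{Γ / stab 1} q̃ • ζ 1 = −1`** (`Tr_{ℚ_p(ζ_p)/ℚ_p} ζ_p = −1`: the conjugates are all the
primitive `p`-th roots `ζ^a`, `1 ≤ a < p`). [cite: Kobayashi2003, Lemma 8.9 (proof)] -/
theorem sum_out_smul_zeta_one [Fintype (stab p 0 ⧸ (stab p 1).subgroupOf (stab p 0))] :
    ∑ q : stab p 0 ⧸ (stab p 1).subgroupOf (stab p 0),
        ((q.out : stab p 0) : absoluteGaloisGroup ℚ_[p]) • zeta p 1 = -1 := by
  have hω : IsPrimitiveRoot (zeta p 1) p := by simpa using isPrimitiveRoot_zeta p 1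
  haveI : NeZero p := ⟨hp.out.ne_zero⟩
  set T : Finset (PadicAlgCl p) := (Finset.Ico 1 p).image fun a => zeta p 1 ^ a with hT
  have hinj : Set.InjOn (fun a => zeta p 1 ^ a) (Finset.Ico 1 p : Set ℕ) := by
    intro a ha a' ha' h
    simp only [Finset.coe_Ico, Set.mem_Ico] at ha ha'
    exact hω.pow_inj ha.2 ha'.2 h
  have hTcard : T.card = p - 1 := by rw [hT, Finset.card_image_of_injOn hinj, Nat.card_Ico]
  have hQcard : Fintype.card (stab p 0 ⧸ (stab p 1).subgroupOf (stab p 0)) = T.card := by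
    rw [hTcard, ← Nat.card_eq_fintype_card, ← Subgroup.index, index_subgroupOf_stab_succ, if_pos rfl]
  rw [sum_eq_finset_sum_of_injective p (out_smul_zeta_injective 0) T (fun q => ?_) hQcard]
  · rw [hT, Finset.sum_image hinj]
    have h := hω.geom_sum_eq_zero hp.out.one_lt
    rw [Finset.range_eq_Ico, Finset.sum_eq_sum_Ico_succ_bot hp.out.pos, pow_zero] at h
    linear_combination h
  · -- `q̃ • ζ_p` is a primitive `p`-th root, i.e. `ζ_p^a` with `1 ≤ a < p`
    set σ : absoluteGaloisGroup ℚ_[p] := ((q.out : stab p 0) : absoluteGaloisGroup ℚ_[p])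
    have hprim : IsPrimitiveRoot (σ • zeta p 1) p := by
      rw [smul_def]
      exact hω.map_of_injective (toAlgEquiv ℚ_[p] σ).injective
    obtain ⟨a, ha, hay⟩ := hω.eq_pow_of_pow_eq_one hprim.pow_eq_one
    have ha0 : a ≠ 0 := by
      rintro rfl
      rw [pow_zero] at hay
      exact hprim.ne_one hp.out.one_lt hay.symm
    rw [hT, Finset.mem_image]
    exact ⟨a, Finset.mem_Ico.mpr ⟨Nat.pos_of_ne_zero ha0, ha⟩, hay⟩

/-- **Kobayashi's trace computation, uniform in the layer**: for EVERY `m ≥ 0`,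
`∑_{stab m / stab (m+1)} q̃ • (ζ (m+1) − 1) = −p` (for `m ≥ 1`: `0 − p·1`; for `m = 0`:
`−1 − (p−1)·1`) — the identities `Tr_{n+1/n}(ζ_{p^{n+2}} − 1) = −p` and `Tr_{k_0/ℚ_p}(ζ_p − 1) = −p`
behind `Tr_{n+1/n} c_{n+1} = −c_{n−1}` in Lemma 8.9. [cite: Kobayashi2003, Lemma 8.9 (proof)] -/
theorem sum_out_smul_zeta_succ_sub_one (m : ℕ)
    [Fintype (stab p m ⧸ (stab p (m + 1)).subgroupOf (stab p m))] :
    ∑ q : stab p m ⧸ (stab p (m + 1)).subgroupOf (stab p m),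
        ((q.out : stab p m) : absoluteGaloisGroup ℚ_[p]) • (zeta p (m + 1) - 1) =
      -(p : PadicAlgCl p) := by
  simp_rw [smul_sub, Finset.sum_sub_distrib, smul_one]
  rw [Finset.sum_const, Finset.card_univ, ← Nat.card_eq_fintype_card, ← Subgroup.index,
    index_subgroupOf_stab_succ]
  rcases Nat.eq_zero_or_pos m with rfl | hm
  · rw [sum_out_smul_zeta_one, if_pos rfl, nsmul_eq_mul, mul_one, Nat.cast_sub hp.out.one_lt.le,
      Nat.cast_one]
    ring
  · rw [sum_out_smul_zeta_succ_of_pos p hm, if_neg hm.ne', nsmul_eq_mul, mul_one]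
    ring

end PadicCyclotomicTower

end Summit.BirchSwinnertonDyer.Rank1Residual.Additive

end
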